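import Summits.Ventures.HSemireg.WeilFrameTwoSlope
import Summits.Ventures.HSemireg.Mod4PointSpectrum

/-!
# Venture HSemireg — TABLE R's «ONE SLOPE AT ∞» ROW ON THE REAL CARRIER, every `n`: the classes `v = B·pt + w`
# (`R_m = 3C(2n,m) − 2C(n,m)`, `R_n = 3C(2n,n) − 2`, Mukai density `(2(−1)ⁿt/(2n)!)·ĥ^{2n}` — the one-slope row again)

HONEST FRAMING. Part of the Lean index of the computation cell `pub-hsemireg` (seat w3-mod4-1 gen 13, W3 SPECIAL FIBRES;
MOD4-OFFSPLIT §13.19 NET: «not covered: the one-slope-at-∞ shape `f = s·pt` alone» — covered here). The tree's real carriers and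
the Literature's Weil-type layer ONLY: no semiregularity map, no Ext group, no `∫`; nothing here says that HC / HC_CM / HC_AV holds;
nothing here is a claim about any explicit variety; no Literature fact is declared; NO definition is introduced. Independent of the
unbuilt `Mod4Carrier*` modules (imports: FILE 22 `WeilFrameTwoSlope` for the pin lemma and the general real-carrier theorems of
FILES 13/20 behind it, and the pure matrix file `Mod4PointSpectrum`).

WHAT IS PROVED, for `A : AbelianVariety ℂ` of dimension `2n` (`n ≥ 1`), `φ ≫ φ = -(d • 𝟙 A)`, `d ≥ 1`, `P, Q` the `±i√d`-eigenspaces,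
`dim (P ⊓ H^{1,0}) = n`, `h` `K`-symmetric of type `(1,1)` with `ĥ^{2n} ≠ 0`, non-zero `c± ∈ E±`, the class
`x = (B/(2n)!) ĥ^{2n} + ĉ₊ + ĉ₋` («`f = B·pt`», `pt = ĥ^{2n}/(2n)!`, `B ≠ 0`: the h-part is a multiple of the point class — the
sequence `q_m = B·[m = 2n]`, written out; `sum_pointSeq_smul_pow` converts the general files' `Σ (q_m/m!) ĥ^m`), pin
`(2n)!·(ĉ₊ĉ₋) = t·ĥ^{2n}`:
* **`finrank_S_point_deg`** — `dim S_m(x) + 2C(n,m) = 3C(2n,m)` for `1 ≤ m ≤ n - 1` (`r_m = 1`, `Mod4.hankel1_rank_point`);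
* **`finrank_S_point_middle`** — `dim S_n(x) + 2 = 3C(2n,n)` (`M_f(q) = 0`, `t ≠ 0` by `pin_ne_zero_weilType`);
* **`proj_mukaiDual_mul_top_point`** — the degree-`4n` part of `x^∨ · x` is `(2(-1)ⁿ t/(2n)!) · ĥ^{2n}` (`P_f(q) = 0`; the point
  class is self-dual: `(-1)^{2n} = 1`).
At `n = 3`: `R = (1, 12, 39, 58, 39, 12, 1)`, the one-slope row (upper half by FILE 15's dual degrees once built), as the degree
reversal `m ↦ 2n − m` of TABLE R predicts for the `λ → ∞` end of the family `A e^{λh}`. Everything PROVED, 0 sorry.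
References: [BuchweitzFlenner2008HH] Prop. 6.4.4; [vanGeemen1994HodgeAV] 4.9, Lemma 5.2; [MumfordAV1970] §16;
[BourbakiAlgebre1a3] Ch. III §8, §11 no. 9.
-/

noncomputable section

open CliffordAlgebra (contractLeft)
open ExteriorAlgebra (ι)
open Module CategoryTheory
open Literature.AlgebraicGeometry.Motives Literature.AlgebraicGeometry.HodgeTheory
open Literature.AlgebraicTopology.SingularHomology

namespace Summit.Ventures.HSemireg.WeilFrame

open Summit.Ventures.HSemireg.WedgeBridge Summit.Ventures.HSemireg.WeilCarrier Summit.Ventures.HSemireg.Mod4Carrier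
open Summit.Ventures.HSemireg.Wedge.Hankel

/-- the h-part `Σ_{m ≤ N} (q_m/m!) x^m` of the point sequence `q_m = B·[m = N]` is `(B/N!)·x^N`. [cite: BourbakiAlgebre1a3, Ch. III §8] -/
theorem sum_pointSeq_smul_pow {Λ : Type*} [Ring Λ] [Algebra ℂ Λ] (x : Λ) (B : ℂ) (N : ℕ) :
    ∑ m ∈ Finset.range (N + 1), ((if m = N then B else 0) * ((m.factorial : ℕ) : ℂ)⁻¹) • x ^ m =
      (B * ((N.factorial : ℕ) : ℂ)⁻¹) • x ^ N := by
  rw [Finset.sum_eq_single N]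
  · rw [if_pos rfl]
  · intro m _ hm
    rw [if_neg hm, zero_mul, zero_smul]
  · intro h
    exact absurd (Finset.self_mem_range_succ N) h

/-- the dual h-part `Σ_{m ≤ 2n} ((-1)^m q_m/m!) x^m` of the point sequence is again `(B/(2n)!)·x^{2n}` (`(-1)^{2n} = 1`: the point
class is self-dual). [cite: BourbakiAlgebre1a3, Ch. III §8] -/
theorem sum_pointSeq_dual_smul_pow {Λ : Type*} [Ring Λ] [Algebra ℂ Λ] (x : Λ) (B : ℂ) (n : ℕ) :
    ∑ m ∈ Finset.range (n + n + 1), (((-1 : ℂ) ^ m * (if m = n + n then B else 0)) * ((m.factorial : ℕ) : ℂ)⁻¹) • x ^ m =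
      (B * (((n + n).factorial : ℕ) : ℂ)⁻¹) • x ^ (n + n) := by
  rw [Finset.sum_eq_single (n + n)]
  · rw [if_pos rfl, ← two_mul, pow_mul, neg_one_sq, one_pow, one_mul]
  · intro m _ hm
    rw [if_neg hm, mul_zero, zero_mul, zero_smul]
  · intro h
    exact absurd (Finset.self_mem_range_succ (n + n)) h

section RealCarrier

variable {A : AbelianVariety ℂ}

/-- **the point row, lower side degrees on the real carrier** (`1 ≤ m ≤ n - 1`): for `x = (B/(2n)!) ĥ^{2n} + ĉ₊ + ĉ₋`, `B ≠ 0`: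
`dim S_m(x) + 2C(n,m) = 3C(2n,m)` (`r_m = 1`). [cite: BuchweitzFlenner2008HH, Prop. 6.4.4] -/
theorem finrank_S_point_deg (hA : IsSmoothProjective A.dim A.X) {n d : ℕ} (hdim : A.dim = n + n) (hd : 0 < d)
    {φ : A ⟶ A} (hφ : φ ≫ φ = -(d • 𝟙 A)) {P Q : Submodule ℂ (complexBetti A.X 1)}
    (hP : P = Module.End.eigenspace (complexBetti.map φ.hom.hom.hom 1).hom (Complex.I * (Real.sqrt d : ℂ)))
    (hQ : Q = Module.End.eigenspace (complexBetti.map φ.hom.hom.hom 1).hom (-(Complex.I * (Real.sqrt d : ℂ))))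
    (hp : finrank ℂ ↥(P ⊓ hodgeOneZero hA) = n) {h : complexBetti A.X 2}
    (hh : complexBetti.map φ.hom.hom.hom 2 h = (d : ℂ) • h) (h11 : IsOfHodgeType A.dim A.X 2 1 1 h)
    (hvol : ((⋀[ℂ]^2 (complexBetti A.X 1)).subtype ((abelianVarietyCohomologyExteriorH1_holds.equiv A 2).symm h)) ^ (n + n) ≠ 0)
    {cP cQ : complexBetti A.X (2 * n)} (hcP : cP ∈ weilClassesPlus A φ n d) (hcP0 : cP ≠ 0)
    (hcQ : cQ ∈ weilClassesMinus A φ n d) (hcQ0 : cQ ≠ 0)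
    {Bₛ : ℂ} (hBs : Bₛ ≠ 0) {m : ℕ} (hm1 : 1 ≤ m) (hmn : m + 1 ≤ n) :
    finrank ℂ ↥(S ℂ (hodgeZeroOne hA) m
        ((Bₛ * (((n + n).factorial : ℕ) : ℂ)⁻¹) •
            ((⋀[ℂ]^2 (complexBetti A.X 1)).subtype ((abelianVarietyCohomologyExteriorH1_holds.equiv A 2).symm h)) ^ (n + n) +
          (⋀[ℂ]^(2 * n) (complexBetti A.X 1)).subtype ((abelianVarietyCohomologyExteriorH1_holds.equiv A (2 * n)).symm cP) +
          (⋀[ℂ]^(2 * n) (complexBetti A.X 1)).subtype ((abelianVarietyCohomologyExteriorH1_holds.equiv A (2 * n)).symm cQ))) + 2 * n.choose m = 3 * (n + n).choose m := by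
  haveI : Module.Finite ℂ (complexBetti A.X 1) := abelianVarietyCohomologyExteriorH1_holds.finite_one A
  have h : finrank ℂ ↥(S ℂ (hodgeZeroOne hA) m
        ((∑ m ∈ Finset.range (n + n + 1), ((if m = n + n then Bₛ else 0) * ((m.factorial : ℕ) : ℂ)⁻¹) •
            ((⋀[ℂ]^2 (complexBetti A.X 1)).subtype ((abelianVarietyCohomologyExteriorH1_holds.equiv A 2).symm h)) ^ m) +
          (⋀[ℂ]^(2 * n) (complexBetti A.X 1)).subtype ((abelianVarietyCohomologyExteriorH1_holds.equiv A (2 * n)).symm cP) +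
          (⋀[ℂ]^(2 * n) (complexBetti A.X 1)).subtype ((abelianVarietyCohomologyExteriorH1_holds.equiv A (2 * n)).symm cQ))) +
        (n.choose m + n.choose m) * (hankel1 ℂ (n + n) m (fun m => if m = n + n then Bₛ else 0)).rank =
      (n + n).choose m + (n + n).choose m +
        (n + n).choose m * (hankel1 ℂ (n + n) m (fun m => if m = n + n then Bₛ else 0)).rank :=
    finrank_S_weilType_deg hA hdim hd hφ hP hQ hp hh h11 hvol hcP hcP0 hcQ hcQ0 (fun m => if m = n + n then Bₛ else 0) hm1 hmn
  rw [sum_pointSeq_smul_pow, Mod4.hankel1_rank_point (by omega) hBs] at h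
  omega

/-- **the point row, middle degree on the real carrier:** `dim S_n(x) + 2 = 3C(2n,n)` (`r_n = 1`, `M_f(q) = 0`, the pin `t ≠ 0`).
[cite: BuchweitzFlenner2008HH, Prop. 6.4.4] -/
theorem finrank_S_point_middle (hA : IsSmoothProjective A.dim A.X) {n d : ℕ} (hdim : A.dim = n + n) (hd : 0 < d)
    {φ : A ⟶ A} (hφ : φ ≫ φ = -(d • 𝟙 A)) {P Q : Submodule ℂ (complexBetti A.X 1)}
    (hP : P = Module.End.eigenspace (complexBetti.map φ.hom.hom.hom 1).hom (Complex.I * (Real.sqrt d : ℂ)))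
    (hQ : Q = Module.End.eigenspace (complexBetti.map φ.hom.hom.hom 1).hom (-(Complex.I * (Real.sqrt d : ℂ))))
    (hp : finrank ℂ ↥(P ⊓ hodgeOneZero hA) = n) {h : complexBetti A.X 2}
    (hh : complexBetti.map φ.hom.hom.hom 2 h = (d : ℂ) • h) (h11 : IsOfHodgeType A.dim A.X 2 1 1 h)
    (hvol : ((⋀[ℂ]^2 (complexBetti A.X 1)).subtype ((abelianVarietyCohomologyExteriorH1_holds.equiv A 2).symm h)) ^ (n + n) ≠ 0)
    {cP cQ : complexBetti A.X (2 * n)} (hcP : cP ∈ weilClassesPlus A φ n d) (hcP0 : cP ≠ 0)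
    (hcQ : cQ ∈ weilClassesMinus A φ n d) (hcQ0 : cQ ≠ 0)
    {Bₛ : ℂ} (hBs : Bₛ ≠ 0) (hn : 1 ≤ n) {t : ℂ}
    (ht : (((n + n).factorial : ℕ) : ℂ) • ((⋀[ℂ]^(2 * n) (complexBetti A.X 1)).subtype ((abelianVarietyCohomologyExteriorH1_holds.equiv A (2 * n)).symm cP) *
        (⋀[ℂ]^(2 * n) (complexBetti A.X 1)).subtype ((abelianVarietyCohomologyExteriorH1_holds.equiv A (2 * n)).symm cQ)) =
      t • ((⋀[ℂ]^2 (complexBetti A.X 1)).subtype ((abelianVarietyCohomologyExteriorH1_holds.equiv A 2).symm h)) ^ (n + n)) :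
    finrank ℂ ↥(S ℂ (hodgeZeroOne hA) n
        ((Bₛ * (((n + n).factorial : ℕ) : ℂ)⁻¹) •
            ((⋀[ℂ]^2 (complexBetti A.X 1)).subtype ((abelianVarietyCohomologyExteriorH1_holds.equiv A 2).symm h)) ^ (n + n) +
          (⋀[ℂ]^(2 * n) (complexBetti A.X 1)).subtype ((abelianVarietyCohomologyExteriorH1_holds.equiv A (2 * n)).symm cP) +
          (⋀[ℂ]^(2 * n) (complexBetti A.X 1)).subtype ((abelianVarietyCohomologyExteriorH1_holds.equiv A (2 * n)).symm cQ))) + 2 = 3 * (n + n).choose n := by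
  haveI : Module.Finite ℂ (complexBetti A.X 1) := abelianVarietyCohomologyExteriorH1_holds.finite_one A
  have ht0 := pin_ne_zero_weilType hA hdim hd hφ hP hQ hp hh h11 hvol hcP hcP0 hcQ hcQ0 ht
  have h : finrank ℂ ↥(S ℂ (hodgeZeroOne hA) n
        ((∑ m ∈ Finset.range (n + n + 1), ((if m = n + n then Bₛ else 0) * ((m.factorial : ℕ) : ℂ)⁻¹) •
            ((⋀[ℂ]^2 (complexBetti A.X 1)).subtype ((abelianVarietyCohomologyExteriorH1_holds.equiv A 2).symm h)) ^ m) +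
          (⋀[ℂ]^(2 * n) (complexBetti A.X 1)).subtype ((abelianVarietyCohomologyExteriorH1_holds.equiv A (2 * n)).symm cP) +
          (⋀[ℂ]^(2 * n) (complexBetti A.X 1)).subtype ((abelianVarietyCohomologyExteriorH1_holds.equiv A (2 * n)).symm cQ))) +
        2 * (hankel1 ℂ (n + n) n (fun m => if m = n + n then Bₛ else 0)).rank +
        finrank ℂ ↥(LinearMap.ker
          (Matrix.toLin' (Mod4.middleM n (fun m => if m = n + n then Bₛ else 0)) - t • LinearMap.id)) =
      ((hankel1 ℂ (n + n) n (fun m => if m = n + n then Bₛ else 0)).rank + 2) * (n + n).choose n :=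
    finrank_S_weilType_middle hA hdim hd hφ hP hQ hp hh h11 hvol hcP hcP0 hcQ hcQ0 hn (fun m => if m = n + n then Bₛ else 0) ht
  rw [sum_pointSeq_smul_pow, Mod4.hankel1_rank_point (by omega) hBs, Mod4.finrank_ker_middleM_point hn Bₛ ht0] at h
  omega

/-- **Mukai density of the point row on the real carrier:** with `x = (B/(2n)!) ĥ^{2n} + ĉ₊ + ĉ₋` and
`x^∨ = (B/(2n)!) ĥ^{2n} + (-1)ⁿ(ĉ₊ + ĉ₋)`, the degree-`4n` part of `x^∨ · x` is `(2(-1)ⁿ t/(2n)!) · ĥ^{2n}` (`P_f(q) = 0`: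
«`(f,f)_χ = 0`», the point class pairs to zero with itself). [cite: MumfordAV1970, §16] [cite: BuchweitzFlenner2008HH, Prop. 6.4.4] -/
theorem proj_mukaiDual_mul_top_point (hA : IsSmoothProjective A.dim A.X) {n d : ℕ} (hdim : A.dim = n + n) (hd : 0 < d)
    {φ : A ⟶ A} (hφ : φ ≫ φ = -(d • 𝟙 A)) {P Q : Submodule ℂ (complexBetti A.X 1)}
    (hP : P = Module.End.eigenspace (complexBetti.map φ.hom.hom.hom 1).hom (Complex.I * (Real.sqrt d : ℂ)))
    (hQ : Q = Module.End.eigenspace (complexBetti.map φ.hom.hom.hom 1).hom (-(Complex.I * (Real.sqrt d : ℂ))))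
    (hp : finrank ℂ ↥(P ⊓ hodgeOneZero hA) = n) {h : complexBetti A.X 2}
    (hh : complexBetti.map φ.hom.hom.hom 2 h = (d : ℂ) • h) (h11 : IsOfHodgeType A.dim A.X 2 1 1 h)
    (hvol : ((⋀[ℂ]^2 (complexBetti A.X 1)).subtype ((abelianVarietyCohomologyExteriorH1_holds.equiv A 2).symm h)) ^ (n + n) ≠ 0)
    {cP cQ : complexBetti A.X (2 * n)} (hcP : cP ∈ weilClassesPlus A φ n d) (hcP0 : cP ≠ 0)
    (hcQ : cQ ∈ weilClassesMinus A φ n d) (hcQ0 : cQ ≠ 0)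
    (Bₛ : ℂ) (hn : 1 ≤ n) {t : ℂ}
    (ht : (((n + n).factorial : ℕ) : ℂ) • ((⋀[ℂ]^(2 * n) (complexBetti A.X 1)).subtype ((abelianVarietyCohomologyExteriorH1_holds.equiv A (2 * n)).symm cP) *
        (⋀[ℂ]^(2 * n) (complexBetti A.X 1)).subtype ((abelianVarietyCohomologyExteriorH1_holds.equiv A (2 * n)).symm cQ)) =
      t • ((⋀[ℂ]^2 (complexBetti A.X 1)).subtype ((abelianVarietyCohomologyExteriorH1_holds.equiv A 2).symm h)) ^ (n + n)) :
    GradedAlgebra.proj (fun i : ℕ => ⋀[ℂ]^i (complexBetti A.X 1)) ((n + n) + (n + n))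
        ((((Bₛ * (((n + n).factorial : ℕ) : ℂ)⁻¹) •
              ((⋀[ℂ]^2 (complexBetti A.X 1)).subtype ((abelianVarietyCohomologyExteriorH1_holds.equiv A 2).symm h)) ^ (n + n)) +
            (-1 : ℂ) ^ n •
              ((⋀[ℂ]^(2 * n) (complexBetti A.X 1)).subtype ((abelianVarietyCohomologyExteriorH1_holds.equiv A (2 * n)).symm cP) +
                (⋀[ℂ]^(2 * n) (complexBetti A.X 1)).subtype ((abelianVarietyCohomologyExteriorH1_holds.equiv A (2 * n)).symm cQ))) *
          (((Bₛ * (((n + n).factorial : ℕ) : ℂ)⁻¹) •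
              ((⋀[ℂ]^2 (complexBetti A.X 1)).subtype ((abelianVarietyCohomologyExteriorH1_holds.equiv A 2).symm h)) ^ (n + n)) +
            (⋀[ℂ]^(2 * n) (complexBetti A.X 1)).subtype ((abelianVarietyCohomologyExteriorH1_holds.equiv A (2 * n)).symm cP) +
            (⋀[ℂ]^(2 * n) (complexBetti A.X 1)).subtype ((abelianVarietyCohomologyExteriorH1_holds.equiv A (2 * n)).symm cQ))) =
      ((2 * ((-1 : ℂ) ^ n * t)) * ((((n + n).factorial : ℕ) : ℂ)⁻¹)) •
        ((⋀[ℂ]^2 (complexBetti A.X 1)).subtype ((abelianVarietyCohomologyExteriorH1_holds.equiv A 2).symm h)) ^ (n + n) := by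
  have h := proj_mukaiDual_mul_top_weilType hA hdim hd hφ hP hQ hp hh h11 hvol hcP hcP0 hcQ hcQ0 hn
    (fun m => if m = n + n then Bₛ else 0) ht
  rw [sum_pointSeq_smul_pow, sum_pointSeq_dual_smul_pow, Mod4.mukaiP_point hn, zero_add] at h
  exact h

end RealCarrier

end Summit.Ventures.HSemireg.WeilFrame

end
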